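import Summits.Langlands.Langlands.Theorems.ParityBlindBianchiResidualBianchiDoorLevelQLevel
import HarnessLib

/-!
# `stub_qLevel_two`: the ℚ-level congruence package from Serre's conjecture MOD 2 alone
# (helper for crux stmt-Langlands-16853 `ParityBlindBianchi.ResidualBianchiDoorLevelBC`, line `Sketch`)

The landed `Sketch.stub_qLevel` (file `ParityBlindBianchiResidualBianchiDoorLevelQLevel.lean`) takes the
tree's named fact `khare_wintenberger p k` for ALL primes `p` but evaluates it only at `p = 2`
(`hKW 2 k`).  This file is the same theorem with the hypothesis cut down to that `p = 2` FIBRE,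
`∀ k, khare_wintenberger 2 k` (Serre's modularity conjecture mod `2`: Khare–Wintenberger (I) Thm 1.2 for
`k(ρ̄) = 2`, Thm 9.1 with Kisin's 2-adic Hypothesis (H) for `k(ρ̄) = 4`), so that the BC-conditional
residual door E1″ can be stated with the minimal displayed debt
(`ResidualBianchiDoorLevelBC_of_serreModTwo` in `ParityBlindBianchiResidualBianchiDoorLevelBC.lean`).
The proof is the landed one verbatim with `hKW 2 k ↦ hKW2 k`; the decorative irreducibility
hypothesis of `stub_qLevel` (implied by the icosahedral one) is dropped.  Nothing is restated: every
ingredient (`stub_residual`, `exists_newform_of_khare_wintenberger_two`, the SerreKW adelic-newform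
stubs, `stub_dictionaryC`, `stub_predictedPolyCongr`) is imported.
-/

noncomputable section

namespace Summit.Langlands.Langlands.Cruxes.ResidualBianchiDoorLevel.Sketch

set_option linter.dupNamespace false

-- (H5) `mixedSpace ℚ` needs classical `Fintype` instances on the place subtypes (as in `AdelicGLnGlue`).
open scoped MatrixGroups Polynomial Valued Classical
open Polynomial NumberField IsDedekindDomain Filter CongruenceSubgroup
open Literature.NumberTheory.Automorphic Literature.NumberTheory.GaloisRepresentations
  Literature.NumberTheory.EllipticCurves.ModularForms

/-- **`stub_qLevel_two`: the ℚ-level congruence package from Serre's conjecture mod `2`** (the landed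
`stub_qLevel`, p101192, with its hypothesis cut down to the `p = 2` fibre of the named fact
`khare_wintenberger` — the only fibre the proof evaluates).  For an icosahedral Artin
`ρ : Γ_ℚ → GL₂(ℂ)` and `ι : ℚ̄₂ ≃ ℂ` there are a finite set of PRIMES `S ∋ 2`, the entrywise model
`σ₀ = GL₂(ι⁻¹) ∘ ρ`, and a regular algebraic cuspidal `π` on `GL₂(𝔸_ℚ)` such that at EVERY place `v`
over no prime of `S`: `π` has a Satake parameter `α`, `σ₀` is unramified at `v`,
`charpoly σ₀(Frob_v) = (X - a)(X - b)` with `a, b ∈ ℤ̄₂`, congruent coefficientwise in `𝔪_{ℤ̄₂}` to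
`arithFrobPolyOfSatake ι q_v 2 α`.  Proof: `stub_residual` (+ `isOdd_of_charP_two`) feeds
`exists_newform_of_khare_wintenberger_two` (weight `2` or `4`, EVEN); residue-adapted embedding,
conjugate newform, adelic lift, arch parameter (landed SerreKW stubs 2–6); `stub_dictionaryC`;
`stub_predictedPolyCongr`; `S := {2} ∪ primes(N M) ∪` (the finitely many a.e.-exceptional and
`σ₀`-ramified primes). [cite: KhareWintenberger2009, Thm. 1.2 and Thm. 9.1] -/
theorem stub_qLevel_two
    (hKW2 : ∀ (k : Type) [Field k] [TopologicalSpace k] [DiscreteTopology k],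
      khare_wintenberger 2 k)
    (ι : PadicAlgCl 2 ≃+* ℂ) (ρ : FramedGaloisRep ℚ ℂ 2)
    (hA5 : Nonempty ((Matrix.ProjGenLinGroup.mk.comp ρ.toMonoidHom).range ≃*
      alternatingGroup (Fin 5))) :
    ∃ S : Finset ℕ, 2 ∈ S ∧ (∀ ℓ ∈ S, ℓ.Prime) ∧ ∃ σ₀ : FramedGaloisRep ℚ (PadicAlgCl 2) 2,
      σ₀.toMonoidHom = (Matrix.GeneralLinearGroup.map ι.symm.toRingHom).comp ρ.toMonoidHom ∧
      ∃ (hcpt : isCompact_glFiniteIntegralLevel 2 ℚ) (π : CuspidalAutomorphicRepData 2 ℚ hcpt),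
        π.1.IsRegularAlgebraic ∧
        ∀ v : HeightOneSpectrum (𝓞 ℚ), (∀ ℓ ∈ S, ((ℓ : ℕ) : 𝓞 ℚ) ∉ v.asIdeal) →
          ∃ (α : Multiset ℂ) (a b : PadicAlgCl 2), ‖a‖ ≤ 1 ∧ ‖b‖ ≤ 1 ∧
            π.1.HasSatakeParamAt v α ∧ σ₀.IsUnramifiedAt v ∧
            σ₀.HasFrobCharpolyAt v ((X - C a) * (X - C b)) ∧
            ∀ i : ℕ, ‖((X - C a) * (X - C b)).coeff i -
              (arithFrobPolyOfSatake ι v.residueCard 2 α).coeff i‖ < 1 := by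
  classical
  haveI : Fact (Nat.Prime 2) := ⟨Nat.prime_two⟩
  -- (0) the entrywise model `σ₀ = GL₂(ι⁻¹) ∘ ρ`
  haveI : Finite ρ.toMonoidHom.range := finite_range_toMonoidHom ρ
  obtain ⟨σ₀, hσ₀, hfin, ⟨e₀⟩⟩ :=
    Summit.Langlands.Langlands.Theorems.ResidualBianchiDoorMod2.exists_map_ringEquiv ρ ι.symm
  obtain ⟨e⟩ := hA5
  have hA5σ : Nonempty (projectiveImage σ₀.toMonoidHom ≃* alternatingGroup (Fin 5)) := ⟨e₀.trans e⟩
  -- (1) the residue field `k` (an algebraic closure of `ℤ̄₂/𝔪`, discrete) and the reduction `red`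
  let O : Subring (PadicAlgCl 2) := 𝒪[PadicAlgCl 2]
  let k : Type := AlgebraicClosure (IsLocalRing.ResidueField O)
  letI : TopologicalSpace k := ⊥
  haveI : DiscreteTopology k := ⟨rfl⟩
  let red : O →+* k := (algebraMap (IsLocalRing.ResidueField O) k).comp (IsLocalRing.residue O)
  have hred : ∀ x : O, red x = 0 ↔ ‖(x : PadicAlgCl 2)‖ < 1 := by
    intro x
    rw [RingHom.comp_apply, map_eq_zero_iff _ (algebraMap (IsLocalRing.ResidueField O) k).injective,
      IsLocalRing.residue_eq_zero_iff, IsLocalRing.mem_maximalIdeal, mem_nonunits_iff,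
      Valuation.Integer.not_isUnit_iff_valuation_lt_one, PadicAlgCl.valuation_def,
      ← NNReal.coe_lt_coe, coe_nnnorm, NNReal.coe_one]
  have h2norm : ‖(2 : PadicAlgCl 2)‖ < 1 := by
    have h : ‖((2 : ℕ) : PadicAlgCl 2)‖ = 1 / 2 := by
      rw [← PadicAlgCl.valuation_coe, PadicAlgCl.valuation_p]
      norm_num
    rw [Nat.cast_ofNat] at h
    rw [h]
    norm_num
  haveI : CharP k 2 := by
    have h2 : (2 : k) = 0 := by
      have h : red 2 = 0 := (hred 2).mpr (by
        have h' : ((2 : O) : PadicAlgCl 2) = 2 := by norm_cast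
        rw [h']
        exact h2norm)
      rwa [map_ofNat] at h
    exact CharTwo.of_one_ne_zero_of_two_eq_zero one_ne_zero h2
  -- (2) the residual representation
  obtain ⟨σbar, hirrbar, hchar⟩ := stub_residual red hred σ₀ hfin hA5σ
  -- (3) Khare–Wintenberger at `p = 2`: a newform of weight `2` or `4`
  obtain ⟨N, _instN, w, f, ιf, _h2N, hw24, hf, hKWf⟩ :=
    Summit.Langlands.Langlands.Theorems.ResidualBianchiDoorMod2.exists_newform_of_khare_wintenberger_two
      (hKW2 k) σbar hirrbar
  -- (4) residue-adapted embedding and the conjugate newform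
  obtain ⟨τ, θ, hθ, hredθ⟩ :=
    Summit.Langlands.Langlands.Cruxes.SerreKWAutomorphicGL2.AdelicNewformDatumDoubleTwist.stub_residueAdaptedEmbedding
      2 k red ι N _ f hf ιf
  obtain ⟨M, _instM, g, hg, hconj⟩ :=
    Summit.Langlands.Langlands.Cruxes.SerreKWAutomorphicGL2.AdelicNewformDatumDoubleTwist.stub_conjugateNewform
      N _ f hf τ
  -- (5) the automorphic side for `g`
  have hcpt₂ : isCompact_glFiniteIntegralLevel 2 ℚ := isCompact_glFiniteIntegralLevel_holds 2 ℚ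
  have hw' : (2 : ℤ) ≤ ((w : ℕ) : ℤ) := by rcases hw24 with rfl | rfl <;> norm_num
  have hweven : Even ((w : ℕ) : ℤ) := by
    rcases hw24 with rfl | rfl
    · exact ⟨1, by norm_num⟩
    · exact ⟨2, by norm_num⟩
  obtain ⟨hsm, hlow⟩ :=
    Summit.Langlands.Langlands.Cruxes.SerreKWAutomorphicGL2.AdelicNewformDatumDoubleTwist.stub_loweringKillsLift
      M _ g hcpt₂
  have hφ : adelicLiftFunA M (w : ℤ) ⇑g ∈ cuspFormsGL 2 ℚ hcpt₂ :=
    (Summit.Langlands.Langlands.Cruxes.SerreKWAutomorphicGL2.AdelicNewformDatumDoubleTwist.stub_adelicLiftIsCuspForm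
      M _ hw' g hcpt₂ hsm hlow).mem_cuspFormsGL
  have hφ0 : adelicLiftFunA M (w : ℤ) ⇑g ≠ 0 :=
    Summit.Langlands.Langlands.Cruxes.SerreKWAutomorphicGL2.AdelicNewformDatumDoubleTwist.adelicLiftFunA_ne_zero_of_isNewform1 hg
  have harch :=
    Summit.Langlands.Langlands.Cruxes.SerreKWAutomorphicGL2.AdelicNewformDatumDoubleTwist.stub_archParameterOfGeneratedDatum
      M _ g hcpt₂ hlow hφ hφ0
  obtain ⟨π₂, hRA, hsat₂⟩ :=
    stub_dictionaryC M _ hw' hweven g hg hcpt₂ (CuspidalAutomorphicRepData.ofCuspForm hφ hφ0)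
      (CuspidalAutomorphicRepData.mem_W_ofCuspForm hφ hφ0)
      (CuspidalAutomorphicRepData.not_mem_W'_ofCuspForm hφ hφ0) harch
  -- (6) the finite exceptional sets and `S`
  have hunr : ∀ᶠ v : HeightOneSpectrum (𝓞 ℚ) in Filter.cofinite, σ₀.IsUnramifiedAt v := by
    haveI := hfin
    exact σ₀.eventually_isUnramifiedAt_of_isOpen_ker (isOpen_ker_of_finite_range σ₀)
  obtain ⟨B, hBfin, hB⟩ : ∃ B : Set (HeightOneSpectrum (𝓞 ℚ)), B.Finite ∧ ∀ v ∉ B,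
      σ₀.IsUnramifiedAt v ∧ π₂.1.HasSatakeParamAt v
        (((heckePolynomial g ((Rat.HeightOneSpectrum.primesEquiv v : Nat.Primes) : ℕ)).map
            (algebraMap (coeffCharField g) ℂ)).roots.map
          (fun β => (((Real.sqrt ((Rat.HeightOneSpectrum.primesEquiv v : Nat.Primes) : ℕ)
            : ℝ) : ℂ)) ^ ((w : ℤ) - 1) * β⁻¹)) := by
    have h := hunr.and hsat₂
    rw [Filter.eventually_cofinite] at h
    exact ⟨_, h, fun v hv => not_not.mp hv⟩
  let S : Finset ℕ :=
    insert 2 ((N * M).primeFactors ∪ hBfin.toFinset.image Rat.HeightOneSpectrum.natGenerator)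
  refine ⟨S, Finset.mem_insert_self _ _, ?_, σ₀, hσ₀, hcpt₂, π₂, hRA, ?_⟩
  · intro ℓ hℓ
    rcases Finset.mem_insert.mp hℓ with rfl | hℓ
    · exact Nat.prime_two
    rcases Finset.mem_union.mp hℓ with hℓ | hℓ
    · exact Nat.prime_of_mem_primeFactors hℓ
    · obtain ⟨v, -, rfl⟩ := Finset.mem_image.mp hℓ
      exact Rat.HeightOneSpectrum.prime_natGenerator v
  -- (7) at a good place `v`
  intro v hv
  set q : ℕ := Rat.HeightOneSpectrum.natGenerator v with hqdef
  have hpq : ((Rat.HeightOneSpectrum.primesEquiv v : Nat.Primes) : ℕ) = q := rfl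
  have hqS : q ∉ S := fun h => hv q h ((Rat.natCast_mem_asIdeal_iff v).2 dvd_rfl)
  have hqp : q.Prime := Rat.HeightOneSpectrum.prime_natGenerator v
  have hq2 : q ≠ 2 := fun h => hqS (h ▸ Finset.mem_insert_self _ _)
  have hqodd : Odd q := hqp.odd_of_ne_two hq2
  have hvB : v ∉ B := fun h => hqS (Finset.mem_insert_of_mem (Finset.mem_union_right _
    (Finset.mem_image.mpr ⟨v, hBfin.mem_toFinset.mpr h, rfl⟩)))
  have hNM : N * M ≠ 0 := mul_ne_zero (NeZero.ne N) (NeZero.ne M)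
  have hqNM : ¬ q ∣ N * M := fun h =>
    hqS (Finset.mem_insert_of_mem (Finset.mem_union_left _ (Nat.mem_primeFactors.mpr ⟨hqp, h, hNM⟩)))
  have hqN2 : ((Rat.HeightOneSpectrum.primesEquiv v : Nat.Primes) : ℕ) ∉ {q | q ∣ N * 2} := by
    rw [hpq]
    intro h
    rcases (Nat.Prime.dvd_mul hqp).mp h with h | h
    · exact hqNM (h.mul_right M)
    · exact hq2 ((Nat.prime_dvd_prime_iff_eq hqp Nat.prime_two).mp h)
  obtain ⟨hunrv, hsatv⟩ := hB v hvB
  rw [hpq] at hsatv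
  -- KW's local clause, a Frobenius at `v`, the residual char-poly bridge
  obtain ⟨-, Pint, hPint, hFrob⟩ := hKWf v hqN2
  rw [hpq] at hPint
  obtain ⟨𝔓, h𝔓⟩ := HeightOneSpectrum.primesAbove_nonempty v
  obtain ⟨φ, hφF⟩ := HeightOneSpectrum.exists_isArithFrobAt_of_mem_primesAbove_holds h𝔓
  obtain ⟨P, a, b, ha, hb, hPab, hPσ, hPbar⟩ := hchar φ
  -- `σ₀` unramified at `v` ⇒ every Frobenius at `v` has char-poly `charpoly σ₀(φ) = (X-a)(X-b)`
  have hunrG : σ₀.toGaloisRep.IsUnramifiedAt v := (σ₀.isUnramifiedAt_toGaloisRep_iff v).mpr hunrv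
  have hF : σ₀.HasFrobCharpolyAt v ((σ₀.toGaloisRep φ).charpoly) :=
    (FramedGaloisRep.hasFrobCharpolyAt_toGaloisRep_iff v _ σ₀).mp
      (hunrG.hasFrobCharpolyAt_charpoly h𝔓 hφF)
  have hkey : (σ₀.toGaloisRep φ).charpoly = (X - C a) * (X - C b) := by
    rw [← hF 𝔓 h𝔓 φ hφF]
    show ((σ₀ φ : GL (Fin 2) (PadicAlgCl 2)) : Matrix (Fin 2) (Fin 2) (PadicAlgCl 2)).charpoly = _
    rw [hPσ, hPab]
  rw [hkey] at hF
  refine ⟨_, a, b, ha, hb, hsatv, hunrv, hF, ?_⟩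
  -- the congruence: `P ≡ θ(P_q)` (both reduce to `charpoly σ̄(φ)`) and `stub_predictedPolyCongr`
  have hqv : v.residueCard = q := Rat.residueCard_eq_natGenerator v
  rw [hqv]
  set Hg : ℂ[X] := (heckePolynomial g q).map (algebraMap (coeffCharField g) ℂ) with hHg
  have hHgmonic : Hg.Monic := (monic_heckePolynomial g q).map _
  have hHgdeg : Hg.natDegree = 2 := by
    rw [hHg, map_heckePolynomial]
    compute_degree!
  have hθ' : (𝒪[PadicAlgCl 2]).subtype.comp θ =
      ((ι.symm : ℂ →+* PadicAlgCl 2).comp τ).comp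
        (algebraMap (coeffCharIntegers f) (coeffCharField f)) :=
    RingHom.ext fun x => hθ x
  have hQH : (Pint.map θ).map (𝒪[PadicAlgCl 2]).subtype = Hg.map (ι.symm : ℂ →+* PadicAlgCl 2) := by
    rw [Polynomial.map_map, hθ', ← Polynomial.map_map, ← Polynomial.map_map, hPint,
      ← hconj q hqp hqNM, hHg]
  have hcongr := stub_predictedPolyCongr ι hqodd (w : ℤ) (Pint.map θ) Hg hHgmonic hHgdeg hQH
  have hredθ' : red.comp θ = ιf := RingHom.ext hredθ
  have hdiff : ∀ i : ℕ, ‖(P.map (𝒪[PadicAlgCl 2]).subtype).coeff i -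
      ((Pint.map θ).map (𝒪[PadicAlgCl 2]).subtype).coeff i‖ < 1 := by
    intro i
    have h1 : (P - Pint.map θ).map red = 0 := by
      rw [Polynomial.map_sub, Polynomial.map_map, hredθ', ← hPbar, sub_eq_zero]
      exact hFrob 𝔓 h𝔓 φ hφF
    have h2 : red ((P - Pint.map θ).coeff i) = 0 := by
      have := congrArg (fun R : Polynomial k => R.coeff i) h1
      simpa only [Polynomial.coeff_map, Polynomial.coeff_zero] using this
    have h3 := (hred _).mp h2
    rw [Polynomial.coeff_map, Polynomial.coeff_map, ← map_sub, ← Polynomial.coeff_sub]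
    exact h3
  intro i
  rw [← hPab]
  set x₁ := (P.map (𝒪[PadicAlgCl 2]).subtype).coeff i
  set x₂ := ((Pint.map θ).map (𝒪[PadicAlgCl 2]).subtype).coeff i
  set x₃ := (arithFrobPolyOfSatake ι q 2
    (Hg.roots.map fun β => (((Real.sqrt q : ℝ) : ℂ)) ^ ((w : ℤ) - 1) * β⁻¹)).coeff i
  have htri := dist_triangle_max x₁ x₂ x₃
  simp only [dist_eq_norm] at htri
  exact lt_of_le_of_lt htri (max_lt (hdiff i) (hcongr i))

end Summit.Langlands.Langlands.Cruxes.ResidualBianchiDoorLevel.Sketch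

end
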